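import Mathlib
import Literature.Probability.MarkovChains.ModifiedLogSobolevConstant
import HarnessLib

/-!
# Route `ColdStartUniversality` (fixed-cut-off package, entropy side): ABSTRACT ENTROPY-FLOW TOOLKIT — the four elementary
# inequalities behind «log-Sobolev ⇒ exponential decay of entropy» (Bakry–Gentil–Ledoux Thm 5.2.1), with no Markov object

Helper file (seat `ym-line-csu-p1`, g21; `--supports stmt-QuantumFields-27363`).  Pure real analysis / measure theory:

(The pointwise inequality `4(√a − √b)² ≤ (a − b)(log a − log b)` turning the entropy production `𝓔(u, log u)` into the energy of
`√u` is the tree's `Literature.Probability.MarkovChains.four_mul_sq_sqrt_sub_le` — imported, not restated.)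
* ★ `integral_mul_log_le_integral_mul_log` — GIBBS' INEQUALITY `∫ u log v dν ≤ ∫ u log u dν` for `u ≥ 0`, `v > 0` of equal mass;
* `abs_sub_le_add_mul_of_uniformContinuous` / ★ `tendsto_integral_comp_of_tendsto_integral_abs_sub` — for continuous `φ` and
  uniformly bounded `w_i → w` in `L¹(ν)` (finite `ν`): `∫ φ(w_i) dν → ∫ φ(w) dν` (uniform continuity on a compact interval +
  the split `|φ a − φ b| ≤ ε + (2M/δ)|a − b|`; no subsequence extraction);
* ★ `tendsto_integral_comp_of_tendstoUniformly` — the same along uniformly convergent nets;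
* ★ `le_mul_exp_neg_mul_of_slope` — FENCING: a continuous `φ ≥ 0` on `[0, ∞)` whose lower right Dini derivative is `≤ −c φ`
  (`c > 0`) satisfies `φ t ≤ φ 0 · e^{−ct}` (`image_le_of_liminf_slope_right_lt_deriv_boundary` against `(φ 0 + ε)e^{−c't}`, `c' < c`).

THEOREMS ONLY, no definition, no sorry, [folklore] throughout.  Nothing here is specific to Yang–Mills; no crux, rung or summit
statement is proved; the Yang–Mills mass gap is NOT proved.
-/

set_option autoImplicit false

noncomputable section

namespace Summit.QuantumFields.YangMills.Theorems.ColdStartUniversality.EntropyFlow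

open MeasureTheory Filter Set Topology Real
open scoped NNReal ENNReal

/-! ## §1. Gibbs' inequality -/

/-- `u log v − u log u ≤ v − u` for `u ≥ 0`, `v > 0` (`log x ≤ x − 1` at `x = v/u`). [folklore] -/
theorem mul_log_sub_mul_log_le {u v : ℝ} (hu : 0 ≤ u) (hv : 0 < v) : u * Real.log v - u * Real.log u ≤ v - u := by
  rcases hu.lt_or_eq with hu' | hu'
  · have h := Real.log_le_sub_one_of_pos (div_pos hv hu')
    rw [Real.log_div hv.ne' hu'.ne'] at h
    have h2 := mul_le_mul_of_nonneg_left h hu'.le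
    have e : u * (v / u - 1) = v - u := by field_simp
    rw [e] at h2
    linarith
  · rw [← hu']; simp [hv.le]

/-- ★ **Gibbs' inequality**: for `u ≥ 0` and `v > 0` with `∫ v dν = ∫ u dν` (all integrals finite), `∫ u log v dν ≤ ∫ u log u dν`.
[folklore] -/
theorem integral_mul_log_le_integral_mul_log {X : Type*} [MeasurableSpace X] {ν : Measure X} {u v : X → ℝ}
    (hu : ∀ x, 0 ≤ u x) (hv : ∀ x, 0 < v x) (hui : Integrable u ν) (hvi : Integrable v ν)
    (huv : Integrable (fun x => u x * Real.log (v x)) ν) (huu : Integrable (fun x => u x * Real.log (u x)) ν)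
    (hmass : ∫ x, v x ∂ν = ∫ x, u x ∂ν) :
    ∫ x, u x * Real.log (v x) ∂ν ≤ ∫ x, u x * Real.log (u x) ∂ν := by
  have h : ∫ x, (u x * Real.log (v x) - u x * Real.log (u x)) ∂ν ≤ ∫ x, (v x - u x) ∂ν :=
    integral_mono (huv.sub huu) (hvi.sub hui) fun x => mul_log_sub_mul_log_le (hu x) (hv x)
  rw [integral_sub huv huu, integral_sub hvi hui, hmass, sub_self] at h
  linarith

/-! ## §2. Integrals of `φ ∘ w` under `L¹` and uniform convergence of bounded `w` -/

/-- **Splitting a uniformly continuous function**: for `φ` continuous, `R ≥ 0` and `ε > 0` there are `δ > 0` and `C ≥ 0` with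
`|φ a − φ b| ≤ ε + C |a − b|` for all `a, b ∈ [−R, R]` (`C = 2 sup_{[−R,R]} |φ| / δ`). [folklore] -/
theorem abs_sub_le_add_mul_of_continuous {φ : ℝ → ℝ} (hφ : Continuous φ) {R : ℝ} (hR : 0 ≤ R) {ε : ℝ} (hε : 0 < ε) :
    ∃ δ C : ℝ, 0 < δ ∧ 0 ≤ C ∧ ∀ a b : ℝ, |a| ≤ R → |b| ≤ R → |φ a - φ b| ≤ ε + C * |a - b| := by
  have hK : IsCompact (Icc (-R) R) := isCompact_Icc
  have huc : UniformContinuousOn φ (Icc (-R) R) := hK.uniformContinuousOn_of_continuous hφ.continuousOn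
  rw [Metric.uniformContinuousOn_iff] at huc
  obtain ⟨δ, hδ, hδε⟩ := huc ε hε
  obtain ⟨M, hM⟩ := hK.exists_bound_of_continuousOn hφ.continuousOn
  have hM0 : 0 ≤ M := le_trans (norm_nonneg _) (hM 0 (by simp [hR]))
  refine ⟨δ, 2 * M / δ, hδ, by positivity, fun a b ha hb => ?_⟩
  have ha' : a ∈ Icc (-R) R := abs_le.1 ha
  have hb' : b ∈ Icc (-R) R := abs_le.1 hb
  by_cases hab : |a - b| < δ
  · have h1 : dist a b < δ := by rwa [Real.dist_eq]
    have h2 := hδε a ha' b hb' h1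
    rw [Real.dist_eq] at h2
    have : 0 ≤ 2 * M / δ * |a - b| := by positivity
    linarith [h2.le]
  · push Not at hab
    have h1 : |φ a - φ b| ≤ 2 * M := by
      have h3 := hM a ha'
      have h4 := hM b hb'
      rw [Real.norm_eq_abs] at h3 h4
      calc |φ a - φ b| ≤ |φ a| + |φ b| := abs_sub _ _
        _ ≤ M + M := add_le_add h3 h4
        _ = 2 * M := by ring
    have h2 : 2 * M ≤ 2 * M / δ * |a - b| := by
      rw [div_mul_eq_mul_div, le_div_iff₀ hδ]
      exact mul_le_mul_of_nonneg_left hab (by positivity)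
    linarith

/-- ★ **`L¹` convergence of uniformly bounded functions passes through continuous non-linearities**: if `∫ |w_i − w| dν → 0` along a
filter, `|w_i|, |w| ≤ R`, `ν` finite and `φ` continuous, then `∫ φ(w_i) dν → ∫ φ(w) dν`. [folklore] -/
theorem tendsto_integral_comp_of_tendsto_integral_abs_sub {X : Type*} [MeasurableSpace X] {ν : Measure X} [IsFiniteMeasure ν]
    {ι : Type*} {l : Filter ι} {w : ι → X → ℝ} {w₀ : X → ℝ}
    (hwm : ∀ i, AEStronglyMeasurable (w i) ν) (hw₀m : AEStronglyMeasurable w₀ ν)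
    {R : ℝ} (hR : ∀ i x, |w i x| ≤ R) (hR₀ : ∀ x, |w₀ x| ≤ R)
    (hL1 : Tendsto (fun i => ∫ x, |w i x - w₀ x| ∂ν) l (𝓝 0)) {φ : ℝ → ℝ} (hφ : Continuous φ) :
    Tendsto (fun i => ∫ x, φ (w i x) ∂ν) l (𝓝 (∫ x, φ (w₀ x) ∂ν)) := by
  rcases isEmpty_or_nonempty X with hX | hX
  · have e : ∀ f : X → ℝ, ∫ x, f x ∂ν = 0 := fun f => by
      rw [Measure.eq_zero_of_isEmpty ν]; simp
    simp only [e]; exact tendsto_const_nhds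
  have hR0 : 0 ≤ R := le_trans (abs_nonneg _) (hR₀ (Classical.arbitrary X))
  -- integrability of everything in sight
  obtain ⟨M, hM⟩ := (isCompact_Icc (a := -R) (b := R)).exists_bound_of_continuousOn hφ.continuousOn
  have hφwi : ∀ i, Integrable (fun x => φ (w i x)) ν := fun i =>
    Integrable.of_bound (hφ.comp_aestronglyMeasurable (hwm i)) M
      (ae_of_all _ fun x => hM _ (abs_le.1 (hR i x)))
  have hφw₀ : Integrable (fun x => φ (w₀ x)) ν :=
    Integrable.of_bound (hφ.comp_aestronglyMeasurable hw₀m) M (ae_of_all _ fun x => hM _ (abs_le.1 (hR₀ x)))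
  have hdi : ∀ i, Integrable (fun x => |w i x - w₀ x|) ν := fun i =>
    Integrable.of_bound ((hwm i).sub hw₀m).norm (R + R) (ae_of_all _ fun x => by
      rw [Real.norm_eq_abs, abs_abs]
      exact (abs_sub _ _).trans (add_le_add (hR i x) (hR₀ x)))
  rw [Metric.tendsto_nhds]
  intro ε hε
  -- split `|φ a − φ b| ≤ ε' + C|a − b|` with `ε' ν(X) ≤ ε/2`
  set m : ℝ := ν.real univ with hm
  have hm0 : 0 ≤ m := measureReal_nonneg
  obtain ⟨δ, C, hδ, hC, hsplit⟩ := abs_sub_le_add_mul_of_continuous hφ hR0 (show 0 < ε / (2 * (m + 1)) by positivity)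
  have hsmall : ∀ᶠ i in l, C * ∫ x, |w i x - w₀ x| ∂ν < ε / 2 := by
    have ht : Tendsto (fun i => C * ∫ x, |w i x - w₀ x| ∂ν) l (𝓝 (C * 0)) := hL1.const_mul C
    rw [mul_zero] at ht
    exact (Metric.tendsto_nhds.1 ht) (ε / 2) (by positivity) |>.mono fun i hi => by
      rw [Real.dist_eq, sub_zero] at hi
      exact lt_of_le_of_lt (le_abs_self _) hi
  filter_upwards [hsmall] with i hi
  rw [Real.dist_eq]
  have h1 : |(∫ x, φ (w i x) ∂ν) - ∫ x, φ (w₀ x) ∂ν| ≤ ∫ x, |φ (w i x) - φ (w₀ x)| ∂ν := by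
    rw [← integral_sub (hφwi i) hφw₀]
    exact abs_integral_le_integral_abs
  have h2 : ∫ x, |φ (w i x) - φ (w₀ x)| ∂ν ≤ ∫ x, (ε / (2 * (m + 1)) + C * |w i x - w₀ x|) ∂ν :=
    integral_mono ((hφwi i).sub hφw₀).abs ((integrable_const _).add ((hdi i).const_mul C))
      fun x => hsplit _ _ (hR i x) (hR₀ x)
  have h3 : ∫ x, (ε / (2 * (m + 1)) + C * |w i x - w₀ x|) ∂ν = ε / (2 * (m + 1)) * m + C * ∫ x, |w i x - w₀ x| ∂ν := by
    rw [integral_add (integrable_const _) ((hdi i).const_mul C), integral_const, integral_const_mul, smul_eq_mul]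
    ring
  have h4 : ε / (2 * (m + 1)) * m ≤ ε / 2 := by
    rw [div_mul_eq_mul_div, div_le_div_iff₀ (by positivity) (by positivity)]
    nlinarith
  linarith

/-- ★ **Uniform convergence of uniformly bounded functions passes through continuous non-linearities under the integral**:
if `w_i → w` uniformly along a filter, `|w_i|, |w| ≤ R`, `ν` finite and `φ` continuous, then `∫ φ(w_i) dν → ∫ φ(w) dν`. [folklore] -/
theorem tendsto_integral_comp_of_tendstoUniformly {X : Type*} [MeasurableSpace X] {ν : Measure X} [IsFiniteMeasure ν]
    {ι : Type*} {l : Filter ι} {w : ι → X → ℝ} {w₀ : X → ℝ}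
    (hwm : ∀ i, AEStronglyMeasurable (w i) ν) (hw₀m : AEStronglyMeasurable w₀ ν)
    {R : ℝ} (hR : ∀ i x, |w i x| ≤ R) (hR₀ : ∀ x, |w₀ x| ≤ R)
    (hU : TendstoUniformly w w₀ l) {φ : ℝ → ℝ} (hφ : Continuous φ) :
    Tendsto (fun i => ∫ x, φ (w i x) ∂ν) l (𝓝 (∫ x, φ (w₀ x) ∂ν)) := by
  refine tendsto_integral_comp_of_tendsto_integral_abs_sub hwm hw₀m hR hR₀ ?_ hφ
  -- uniform convergence ⇒ `L¹` convergence on a finite measure space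
  rw [Metric.tendsto_nhds]
  intro ε hε
  have hm0 : 0 ≤ ν.real univ := measureReal_nonneg
  have hev := (Metric.tendstoUniformly_iff.1 hU) (ε / (2 * (ν.real univ + 1))) (by positivity)
  filter_upwards [hev] with i hi
  rw [Real.dist_eq, sub_zero]
  have hdi : Integrable (fun x => |w i x - w₀ x|) ν :=
    Integrable.of_bound ((hwm i).sub hw₀m).norm (R + R) (ae_of_all _ fun x => by
      rw [Real.norm_eq_abs, abs_abs]
      exact (abs_sub _ _).trans (add_le_add (hR i x) (hR₀ x)))
  have h1 : ∫ x, |w i x - w₀ x| ∂ν ≤ ∫ x, ε / (2 * (ν.real univ + 1)) ∂ν :=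
    integral_mono hdi (integrable_const _) fun x => by
      have := hi x
      rw [dist_comm, Real.dist_eq] at this
      exact this.le
  rw [integral_const, smul_eq_mul] at h1
  have h2 : ν.real univ * (ε / (2 * (ν.real univ + 1))) < ε := by
    rw [mul_div_assoc', div_lt_iff₀ (by positivity)]
    nlinarith
  rw [abs_of_nonneg (integral_nonneg fun x => abs_nonneg _)]
  exact lt_of_le_of_lt h1 h2

/-! ## §3. Fencing: a Dini-derivative differential inequality gives exponential decay -/

/-- ★ **Exponential decay from a differential inequality on the lower right Dini derivative.**  Let `φ` be continuous on `[0, ∞)`,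
non-negative, and assume that at every `t ≥ 0`, for every `r > −c·φ(t)`, the slopes `(φ(z) − φ(t))/(z − t)` are `< r` frequently as
`z ↓ t` (i.e. `liminf_{z↓t} slope ≤ −c φ(t)`), with `c > 0`.  Then `φ t ≤ φ 0 · e^{−ct}` for all `t ≥ 0`. [folklore] -/
theorem le_mul_exp_neg_mul_of_slope {φ : ℝ → ℝ} {c : ℝ} (hc : 0 < c) (hφc : ContinuousOn φ (Ici 0))
    (hφ0 : ∀ t, 0 ≤ t → 0 ≤ φ t)
    (hD : ∀ t, 0 ≤ t → ∀ r : ℝ, -c * φ t < r → ∃ᶠ z in 𝓝[>] t, slope φ t z < r) :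
    ∀ t, 0 ≤ t → φ t ≤ φ 0 * Real.exp (-c * t) := by
  intro t ht
  -- compare with `B(s) = (φ 0 + ε) e^{−c' s}` for every `ε > 0`, `c' ∈ (0, c)`, then let `ε → 0`, `c' → c`
  have key : ∀ ε : ℝ, 0 < ε → ∀ c' : ℝ, 0 < c' → c' < c → φ t ≤ (φ 0 + ε) * Real.exp (-c' * t) := by
    intro ε hε c' hc' hc'c
    have hB : ∀ x, HasDerivAt (fun s => (φ 0 + ε) * Real.exp (-c' * s)) (-c' * ((φ 0 + ε) * Real.exp (-c' * x))) x := by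
      intro x
      have h1 : HasDerivAt (fun s => -c' * s) (-c') x := by simpa using (hasDerivAt_id x).const_mul (-c')
      have h2 := (h1.exp).const_mul (φ 0 + ε)
      have e : (φ 0 + ε) * (Real.exp (-c' * x) * -c') = -c' * ((φ 0 + ε) * Real.exp (-c' * x)) := by ring
      rw [e] at h2
      exact h2
    have h := image_le_of_liminf_slope_right_lt_deriv_boundary (f := φ) (f' := fun s => -c * φ s) (a := 0) (b := t)
      (hφc.mono Icc_subset_Ici_self) (fun x hx r hr => hD x hx.1 r hr) (B := fun s => (φ 0 + ε) * Real.exp (-c' * s))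
      (B' := fun s => -c' * ((φ 0 + ε) * Real.exp (-c' * s))) (by simp [hε.le]) hB
      (fun x hx hfx => by
        -- at a contact point `φ x = B x > 0`: `−c φ x < −c' B x`
        have hBpos : 0 < (φ 0 + ε) * Real.exp (-c' * x) :=
          mul_pos (by linarith [hφ0 0 le_rfl]) (Real.exp_pos _)
        rw [hfx]
        nlinarith)
    exact h (right_mem_Icc.2 ht)
  -- let `ε ↓ 0` at fixed `c'`
  have key2 : ∀ c' : ℝ, 0 < c' → c' < c → φ t ≤ φ 0 * Real.exp (-c' * t) := by
    intro c' hc' hc'c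
    refine le_of_forall_pos_le_add fun ε hε => ?_
    have h1 := key ε hε c' hc' hc'c
    have h2 : Real.exp (-c' * t) ≤ 1 := by
      rw [Real.exp_le_one_iff]; nlinarith
    nlinarith [Real.exp_pos (-c' * t)]
  -- let `c' ↑ c`
  have hlim : Tendsto (fun c' : ℝ => φ 0 * Real.exp (-c' * t)) (𝓝[<] c) (𝓝 (φ 0 * Real.exp (-c * t))) := by
    have hcont : Continuous fun c' : ℝ => φ 0 * Real.exp (-c' * t) := by fun_prop
    exact (hcont.tendsto c).mono_left nhdsWithin_le_nhds
  refine ge_of_tendsto hlim ?_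
  filter_upwards [Ioo_mem_nhdsLT hc] with c' hc'
  exact key2 c' hc'.1 hc'.2

end Summit.QuantumFields.YangMills.Theorems.ColdStartUniversality.EntropyFlow

end
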